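import Literature.MathematicalPhysics.QuantumFieldTheory.Balaban1983to89.Node00.Record13SClassSepCoPH
import Literature.MathematicalPhysics.QuantumFieldTheory.Balaban1983to89.Node00.Record13SepCoPHChiCmap

/-!
# NODE 00 (YM-PLAN Track A) — THE **S-CLASS** OF THE v1.7 `SepCoPH` RECORD RE-ISSUED **CENTRE-MAP-GENERIC** and its **Ax** instance:
# `IsRecordOfRecord₁₃CSepCoPHSCmap (Χ) D w`, `IsRecordOfRecord₁₃CSepCoPHSAx D w` — plan g99's op-5b supply rows (2)(3)(4) for the K1ᴬ skeleton v11
# (pub-ymgap INBOX I.21959) and for HANDS-3 (ii) (dag-lead WORDS 581)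

WHAT.  dag-n10-d's `Node00/Record13SClassSepCoPH.lean` §1–§2 (the generic S-CLASS `IsRecordOfRecord₁₃CSepCoPHS` of node00-def-T's record predicate: world
bound to the S-BINDING `upOfRecord₅CS` over the Stage-13 view; its pointed form, inhabitation, the skeleton-local `RecordS` receipt, and the consequences
provisos ∕ construction ∕ window ∕ guarded (0.20) ∕ END FROM NODES; plus dag-n24-w1's re-lettering `isRecordOfRecord₁₃CSepCoPHS_reletter_of_le`) RE-ISSUED
with the record's β-slot small-field function read through a CENTRE MAP `Χ : CentreMap F N` (= `Stage13Params F N → ChiSlot F N`, node00-def-Y) — the presenting parameter `θ` is bound INSIDE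
the `∃`, so the slot `Χ θ.toStage13Params` CO-VARIES with `θ` exactly as print's (2.9) cut-off does (refuter CRIT-1 g33 RULING RC-1∕CL (d-i), pub-ymgap STATUS
S.4053; the same shape as node00-def-Y's staged C-class module `Record13SepCoPHChiCmap` and node00-def-RR-2's certificate `rc1/ClassLayerProbe.lean`).  Every
clause reads `[Ax-3d]`'s χ-generic carriers (`Node00/Record13SepCoPHChi`: `Stage13HParams.Provisos₁₃SepCoPHChi`, `datumOfRecord₁₃SepCoPHChi`,
`Stage13HParams.toStage5₁₃CoPHChi`).  The **Ax class** is the instance at the RE-CENTRED cut-off `Χ := chiβOfRecord₁₃Ax F N` (`[Ax-3a]` `Node00/Record13Ax`: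
the (2.9) species centred at print's block-axial representative instead of `Ū^k(Classical.choose …)`; director-ym №467 (D), the K-Ax re-cuts
stmt-QuantumFields-27238∕27239∕27246∕27247).

WHY.  The K1ᴬ skeleton v11 (plan g99 probe `D99-KAX/probe/K1v11c_probe.lean` d11a7f4b60507c60) keys its rung-1 slot on the skeleton-local text
`RecordS F θ (h : θ.Provisos₁₃SepCoPHAx F 2) w` and feeds it to the tree's S-class consequences (`rgFlow_of_smallCouplings_of_…`, `gamma_pos_of_…`,
`construction_eq_of_…`, `…_reletter_of_le`) — which at v10 read node00-def-T's CHOICE-centred provisos `Provisos₁₃SepCoPH` («Application type mismatch»,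
I.21959); and dag-lead HANDS-3 (ii) (`K1EndOfNodes13PWSOfRunRemAt.stabilityB_body_of_rung1At_of_runLetters` Ax, seat dag-n24-c) reads the same four helpers.
This file supplies them ONCE, generic in the centre map, with the Ax names as `abbrev` ∕ one-line instances (the `[Ax-3b]` pattern).  It is the S-CLASS
SIBLING of node00-def-Y's C-class module `Node00/Record13SepCoPHChiCmap` (✓p807974: `CentreMap`, `IsRecordOfRecord₁₃CSepCoPHCmap ∕ CAx`, the C doors) which it
IMPORTS: the binder type is her `CentreMap F N`, the same-constants C-COMPANION of an S-class record lands in her class, and the guarded (0.20) door of the S-class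
is her C door at the companion (parent :118 verbatim); a datum-level, class-free form of that door is also given (§0).  node00-def-RR-2 g26's staged draft of the
same rows (27fa868c04b50863, ceded I.22178) agrees with §1–§2 name for name; dag-lead WORDS 611∕613.

WHAT IS HERE (append-only NEW leaf; nothing landed is edited; no consumer re-keyed):
* §0 `rgFlow_of_smallCouplings_of_C_eq_datumOfRecord₁₃SepCoPHChi` — GUARDED (0.20) at every world bound to a χ-generic Stage-13 datum's construction, ANY χ
  (`T4DatumAssembly.RGMachineCore.rgFlow_of_smallCouplings` at the core of record `coreOfRecord₁₃CoPHChi θ χ`; face `datumOfRecord₁₃SepCoPH_C_chi`, `rfl`).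
* §1 the class: `IsRecordOfRecord₁₃CSepCoPHSCmap` (def) · `isRecordOfRecord₁₃CSepCoPHSCmap_of_eq` · `exists_world_isRecordOfRecord₁₃CSepCoPHSCmap` · RECEIPT
  `isRecordOfRecord₁₃CSepCoPHSCmap_chiβ_iff` (at the centre of record `Χ := chiβOfRecord₁₃ F N` the class IS dag-n10-d's `IsRecordOfRecord₁₃CSepCoPHS`) ·
  `recordS₁₃SepCoPHCmap_iff` (the skeleton-local `RecordS` text at a centre map IS membership, `Iff.rfl`) · the Ax instance `IsRecordOfRecord₁₃CSepCoPHSAx` (abbrev)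
  · `isRecordOfRecord₁₃CSepCoPHSAx_of_eq` · `exists_world_isRecordOfRecord₁₃CSepCoPHSAx` · `recordS₁₃SepCoPHAx_iff`.
* §2 consequences at any centre map: `exists_provisos_of_…SCmap` · `construction_eq_of_…SCmap` · `gamma_pos_of_…SCmap` · `exists_gamma_le_of_…SCmap` · `isDatumOfRecord₀_of_…SCmap` ·
  `isPrintedAveraged_of_…SCmap` · `companionC_of_…SCmap` (the same-constants C-COMPANION IS a def-Y `IsRecordOfRecord₁₃CSepCoPHCmap Χ` record at the same datum) ·
  `rgFlow_of_smallCouplings_of_…SCmap` · `endStatementBPrinted_of_isRecordOfRecord₁₃CSepCoPHSCmap_of_nodes` · `isRecordOfRecord₁₃CSepCoPHSCmap_reletter_of_le`; and the Ax-named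
  one-liners `exists_provisos_of_∕construction_eq_of_∕gamma_pos_of_∕exists_gamma_le_of_∕companionC_of_∕rgFlow_of_smallCouplings_of_isRecordOfRecord₁₃CSepCoPHSAx` ·
  `endStatementBPrinted_of_isRecordOfRecord₁₃CSepCoPHSAx_of_nodes` · `isRecordOfRecord₁₃CSepCoPHSAx_reletter_of_le`.

References (objects of record; bookkeeping — nothing printed is used as a hypothesis): [V] = [Balaban1989LargeFieldII] Commun. Math. Phys. **122** (1989)
355–392, Thm 1 + (0.1) pp.355–356; [III] = [Balaban1988Convergent] Commun. Math. Phys. **119** (1988) 243–285, (0.2) p.244, (2.17)–(2.18) p.257, Thms 1–2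
pp.262–263; [I] = [Balaban1987RG1] Commun. Math. Phys. **109** (1987) 249–301, (0.20) p.256, (2.9) p.266 with (2.3) p.265 (the axial representative);
[Balaban1985RegularSpaces] Commun. Math. Phys. **99** (1985), Thm 8 p.101 (the surviving `b8` of the S-binding).

HONEST FRAMING.  One record predicate over a parameter + an abbrev + kernel bookkeeping (anonymous-constructor records, `rfl`, structure updates, citations of
landed leaves); NO estimate; nothing of Bałaban's asserted; provisos stay HYPOTHESES; no proviso inhabited; no node discharged; K0ᴬ∕K1ᴬ∕K3ᴬ
OPEN (K1ᴬ NOT claimed); counts unmoved (discharged 8∕27 · K 1∕4); a re-issue is not progress on any estimate; one finite 𝕋⁴ programme at fixed ε = L^{−K} —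
NOT continuum ∕ ℝ⁴ ∕ OS ∕ mass gap ∕ Clay.  No `sorry`, no `axiom`, no `instance`, no `notation`; standard axioms.  Seat `pub-ymgap-dag-n24-c` g23 (HUMAN RULING
D-0062 Track A; `--supports stmt-QuantumFields-27239 --as helper`, count-neutral).
-/

noncomputable section

namespace Literature.MathematicalPhysics.QuantumFieldTheory.Balaban1983to89.Node00

open T4Continuum AveragingRT T4FiniteEpsInhabited FlowStep FlowStepRuns DagBinding T4DatumAssembly
open scoped Matrix.Norms.L2Operator

variable (F : T4Family) (N : ℕ) [NeZero N]

/-! ## §0. GUARDED (0.20) at a world bound to a χ-generic Stage-13 datum — class-free, any χ -/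

/-- **GUARDED (0.20) AT EVERY WORLD BOUND TO THE CONSTRUCTION OF A χ-GENERIC STAGE-13 DATUM** (any β-slot function `χ`): along every run whose couplings stay
in `]0, w.γ]` the flow satisfies (0.20) — NO input (the datum's construction IS the assembled construction of the core of record `coreOfRecord₁₃CoPHChi θ χ` over
the densities of record, `datumOfRecord₁₃SepCoPH_C_chi`, `rfl`; in-interval forward-generated runs never halt, `T4DatumAssembly.RGMachineCore.rgFlow_of_smallCouplings`).
The leaf reads `w.C`, `w.γ` only, so BOTH the C-class and the S-class at any centre read it. [cite: Balaban1987RG1, (0.20) p.256] -/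
theorem rgFlow_of_smallCouplings_of_C_eq_datumOfRecord₁₃SepCoPHChi (θ : Stage13HParams F N) (χ : ChiSlot F N) (h : θ.Provisos₁₃SepCoPHChi F N χ)
    (w : WorldP) (hC : w.C = (datumOfRecord₁₃SepCoPHChi F N θ χ h).C) (P : B12.RunParams) (hsc : (leavesP w P).smallCouplings) :
    (leavesP w P).rgFlow :=
  RGMachineCore.rgFlow_of_smallCouplings (coreOfRecord₁₃CoPHChi F N θ χ) (densOfRecord₁₃Chi F N θ.toStage13Params χ) w
    (hC.trans (datumOfRecord₁₃SepCoPH_C_chi F N θ χ h)) P hsc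

/-! ## §1. The S-class of the v1.7 record, CENTRE-MAP-GENERIC, and its Ax instance -/

section SClass

/-- **«(D, w) is the record, Stage 13, v1.7, S-BOUND — β-slot read through the centre map `Χ`»**: dag-n10-d's `IsRecordOfRecord₁₃CSepCoPHS` VERBATIM with the
β-slot small-field function `Χ θ.toStage13Params` threaded through `[Ax-3d]`'s χ-generic provisos ∕ datum ∕ Stage-5 view (`θ` bound INSIDE the `∃`, so the slot
co-varies with `θ` as print's (2.9) cut-off does): admissible v1.7 parameters SATISFYING the χ-generic separated-range provisos whose χ-generic datum of record
IS `D`, construction `w.C = D.C`, window `0 < w.γ ≤ θ.γ`, Bałaban's block size, the world bound to the S-BINDING `upOfRecord₅CS` over the χ-generic Stage-13 view.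
[cite: Balaban1989LargeFieldII, Thm 1 + (0.1) pp.355–356; Balaban1988Convergent, (0.2) p.244, (2.17)–(2.18) p.257, Thms 1–2 pp.262–263; Balaban1987RG1, (2.9) p.266; Balaban1985RegularSpaces, Thm 8 p.101 (the surviving `b8`; objects of record, bookkeeping)] -/
def IsRecordOfRecord₁₃CSepCoPHSCmap (Χ : CentreMap F N) (D : FiniteEpsData F (SU N)) (w : WorldP) : Prop :=
  ∃ (θ : Stage13HParams F N) (h : θ.Provisos₁₃SepCoPHChi F N (Χ θ.toStage13Params)), θ.Admissible F N ∧
    D = datumOfRecord₁₃SepCoPHChi F N θ (Χ θ.toStage13Params) h ∧ w.C = D.C ∧ (0 < w.γ ∧ w.γ ≤ θ.γ) ∧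
    w.L = (θ.L : ℝ) ∧ ∀ P : B12.RunParams, w.up P = upOfRecord₅CS F N (θ.toStage5₁₃CoPHChi F N (Χ θ.toStage13Params)) P

/-- **Pointed form** at any centre map (presenting parameter `θ` itself). [cite: Balaban1989LargeFieldII, Thm 1 + (0.1) pp.355–356 (bookkeeping)] -/
theorem isRecordOfRecord₁₃CSepCoPHSCmap_of_eq (Χ : CentreMap F N) (θ : Stage13HParams F N)
    (h : θ.Provisos₁₃SepCoPHChi F N (Χ θ.toStage13Params)) (hθ : θ.Admissible F N) (w : WorldP)
    (hC : w.C = (datumOfRecord₁₃SepCoPHChi F N θ (Χ θ.toStage13Params) h).C) (hγ : 0 < w.γ ∧ w.γ ≤ θ.γ) (hL : w.L = (θ.L : ℝ))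
    (hup : ∀ P, w.up P = upOfRecord₅CS F N (θ.toStage5₁₃CoPHChi F N (Χ θ.toStage13Params)) P) :
    IsRecordOfRecord₁₃CSepCoPHSCmap F N Χ (datumOfRecord₁₃SepCoPHChi F N θ (Χ θ.toStage13Params) h) w :=
  ⟨θ, h, hθ, rfl, hC, hγ, hL, hup⟩

/-- **Every admissible v1.7 parameter with the χ-generic v1.7 provisos at `Χ θ` presents an S-class record of its own χ-generic datum**, any window `0 < γw ≤ θ.γ`.
[cite: Balaban1989LargeFieldII, Thm 1 + (0.1) pp.355–356 (bookkeeping)] -/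
theorem exists_world_isRecordOfRecord₁₃CSepCoPHSCmap (Χ : CentreMap F N) (θ : Stage13HParams F N)
    (h : θ.Provisos₁₃SepCoPHChi F N (Χ θ.toStage13Params)) (hθ : θ.Admissible F N) {γw : ℝ} (hγw : 0 < γw ∧ γw ≤ θ.γ) :
    ∃ w : WorldP, IsRecordOfRecord₁₃CSepCoPHSCmap F N Χ (datumOfRecord₁₃SepCoPHChi F N θ (Χ θ.toStage13Params) h) w ∧ w.γ = γw ∧ w.L = (θ.L : ℝ) ∧
      ∀ P, w.up P = upOfRecord₅CS F N (θ.toStage5₁₃CoPHChi F N (Χ θ.toStage13Params)) P := by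
  obtain ⟨w₀⟩ := nonempty_worldP
  exact ⟨{ w₀ with
      C := (datumOfRecord₁₃SepCoPHChi F N θ (Χ θ.toStage13Params) h).C, γ := γw, L := (θ.L : ℝ), one_lt_L := by exact_mod_cast θ.hL.2,
      up := fun P => upOfRecord₅CS F N (θ.toStage5₁₃CoPHChi F N (Χ θ.toStage13Params)) P },
    ⟨θ, h, hθ, rfl, rfl, hγw, rfl, fun _ => rfl⟩, rfl, rfl, fun _ => rfl⟩

variable {F N}

/-- **RECEIPT**: at the centre of record `Χ := chiβOfRecord₁₃ F N` the centre-map S-class IS dag-n10-d's S-class `IsRecordOfRecord₁₃CSepCoPHS` (transport of the provisos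
through `provisos₁₃SepCoPHChi_chiβ_iff`; the datum and Stage-5-view clauses are definitional). [cite: Balaban1989LargeFieldII, Thm 1 + (0.1) pp.355–356 (bookkeeping)] -/
theorem isRecordOfRecord₁₃CSepCoPHSCmap_chiβ_iff (D : FiniteEpsData F (SU N)) (w : WorldP) :
    IsRecordOfRecord₁₃CSepCoPHSCmap F N (chiβOfRecord₁₃ F N) D w ↔ IsRecordOfRecord₁₃CSepCoPHS F N D w := by
  constructor
  · rintro ⟨θ, h, hθ, hD, hC, hγ, hL, hup⟩
    exact ⟨θ, (provisos₁₃SepCoPHChi_chiβ_iff θ).1 h, hθ, hD, hC, hγ, hL, hup⟩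
  · rintro ⟨θ, h, hθ, hD, hC, hγ, hL, hup⟩
    exact ⟨θ, (provisos₁₃SepCoPHChi_chiβ_iff θ).2 h, hθ, hD, hC, hγ, hL, hup⟩

/-- **The skeleton-local `RecordS F θ h w` at a centre map IS membership in the centre-map S-class at `datumOfRecord₁₃SepCoPHChi θ (Χ θ) h`** (`Iff.rfl`): a rung-1 slice
ports by `(recordS₁₃SepCoPHCmap_iff …).1 ∕ .2` or `Iff.rfl`. [cite: Balaban1989LargeFieldII, Thm 1 + (0.1) pp.355–356 (bookkeeping)] -/
theorem recordS₁₃SepCoPHCmap_iff (Χ : CentreMap F N) (θ : Stage13HParams F N) (h : θ.Provisos₁₃SepCoPHChi F N (Χ θ.toStage13Params)) (w : WorldP) :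
    (∃ (θ' : Stage13HParams F N) (h' : θ'.Provisos₁₃SepCoPHChi F N (Χ θ'.toStage13Params)), θ'.Admissible F N ∧
        datumOfRecord₁₃SepCoPHChi F N θ (Χ θ.toStage13Params) h = datumOfRecord₁₃SepCoPHChi F N θ' (Χ θ'.toStage13Params) h' ∧
        w.C = (datumOfRecord₁₃SepCoPHChi F N θ (Χ θ.toStage13Params) h).C ∧ (0 < w.γ ∧ w.γ ≤ θ'.γ) ∧
        w.L = (θ'.L : ℝ) ∧ ∀ P : B12.RunParams, w.up P = upOfRecord₅CS F N (θ'.toStage5₁₃CoPHChi F N (Χ θ'.toStage13Params)) P) ↔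
      IsRecordOfRecord₁₃CSepCoPHSCmap F N Χ (datumOfRecord₁₃SepCoPHChi F N θ (Χ θ.toStage13Params) h) w :=
  Iff.rfl

variable (F N)

/-- **THE Ax S-CLASS** (one token): «(D, w) is the record, Stage 13, v1.7, S-bound» RE-CENTRED at print's block-axial critical configuration — the centre-map S-class
at `Χ := chiβOfRecord₁₃Ax F N` (its provisos `θ.Provisos₁₃SepCoPHAx`, datum `datumOfRecord₁₃SepCoPHAx θ h`, Stage-5 view `θ.toStage5₁₃CoPHChi (chiβOfRecord₁₃Ax θ)`, all
by `rfl`). [cite: Balaban1989LargeFieldII, Thm 1 + (0.1) pp.355–356; Balaban1987RG1, (2.9) p.266 with (2.3) p.265 (the axial representative; bookkeeping)] -/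
abbrev IsRecordOfRecord₁₃CSepCoPHSAx (D : FiniteEpsData F (SU N)) (w : WorldP) : Prop :=
  IsRecordOfRecord₁₃CSepCoPHSCmap F N (chiβOfRecord₁₃Ax F N) D w

/-- Pointed intro of the Ax S-class at `[Ax-3d]`'s Ax datum `datumOfRecord₁₃SepCoPHAx F N θ h`. [cite: Balaban1989LargeFieldII, Thm 1 + (0.1) pp.355–356 (bookkeeping)] -/
theorem isRecordOfRecord₁₃CSepCoPHSAx_of_eq (θ : Stage13HParams F N) (h : θ.Provisos₁₃SepCoPHAx F N) (hθ : θ.Admissible F N) (w : WorldP)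
    (hC : w.C = (datumOfRecord₁₃SepCoPHAx F N θ h).C) (hγ : 0 < w.γ ∧ w.γ ≤ θ.γ) (hL : w.L = (θ.L : ℝ))
    (hup : ∀ P, w.up P = upOfRecord₅CS F N (θ.toStage5₁₃CoPHChi F N (chiβOfRecord₁₃Ax F N θ.toStage13Params)) P) :
    IsRecordOfRecord₁₃CSepCoPHSAx F N (datumOfRecord₁₃SepCoPHAx F N θ h) w :=
  ⟨θ, h, hθ, rfl, hC, hγ, hL, hup⟩

/-- Every admissible θ with the Ax provisos presents an Ax-S-class record of its own Ax datum at some world, any window `0 < γw ≤ θ.γ`, block size `θ.L`, S-bound over the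
Ax Stage-5 view. [cite: Balaban1989LargeFieldII, Thm 1 + (0.1) pp.355–356; Balaban1988Convergent, (2.17)–(2.18) p.257 (bookkeeping)] -/
theorem exists_world_isRecordOfRecord₁₃CSepCoPHSAx (θ : Stage13HParams F N) (h : θ.Provisos₁₃SepCoPHAx F N) (hθ : θ.Admissible F N)
    {γw : ℝ} (hγw : 0 < γw ∧ γw ≤ θ.γ) :
    ∃ w : WorldP, IsRecordOfRecord₁₃CSepCoPHSAx F N (datumOfRecord₁₃SepCoPHAx F N θ h) w ∧ w.γ = γw ∧ w.L = (θ.L : ℝ) ∧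
      ∀ P, w.up P = upOfRecord₅CS F N (θ.toStage5₁₃CoPHChi F N (chiβOfRecord₁₃Ax F N θ.toStage13Params)) P :=
  exists_world_isRecordOfRecord₁₃CSepCoPHSCmap F N (chiβOfRecord₁₃Ax F N) θ h hθ hγw

variable {F N}

/-- **The skeleton-local `RecordS F θ (h : θ.Provisos₁₃SepCoPHAx F N) w` of the K-Ax re-cuts IS membership in the Ax S-class at `datumOfRecord₁₃SepCoPHAx θ h`** (`Iff.rfl`) — with
the world's upstream blocks bound over the RE-CENTRED Stage-5 view `θ'.toStage5₁₃CoPHChi (chiβOfRecord₁₃Ax θ')` (there is no `toStage5₁₃CoPHAx` abbrev; the CHOICE-centred view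
`θ'.toStage5₁₃CoPH` would mix centres). [cite: Balaban1989LargeFieldII, Thm 1 + (0.1) pp.355–356; Balaban1987RG1, (2.9) p.266 (bookkeeping)] -/
theorem recordS₁₃SepCoPHAx_iff (θ : Stage13HParams F N) (h : θ.Provisos₁₃SepCoPHAx F N) (w : WorldP) :
    (∃ (θ' : Stage13HParams F N) (h' : θ'.Provisos₁₃SepCoPHAx F N), θ'.Admissible F N ∧
        datumOfRecord₁₃SepCoPHAx F N θ h = datumOfRecord₁₃SepCoPHAx F N θ' h' ∧ w.C = (datumOfRecord₁₃SepCoPHAx F N θ h).C ∧ (0 < w.γ ∧ w.γ ≤ θ'.γ) ∧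
        w.L = (θ'.L : ℝ) ∧ ∀ P : B12.RunParams, w.up P = upOfRecord₅CS F N (θ'.toStage5₁₃CoPHChi F N (chiβOfRecord₁₃Ax F N θ'.toStage13Params)) P) ↔
      IsRecordOfRecord₁₃CSepCoPHSAx F N (datumOfRecord₁₃SepCoPHAx F N θ h) w :=
  Iff.rfl

end SClass

/-! ## §2. CONSEQUENCES of a centre-map S-class record: provisos, construction, window, guarded (0.20), END FROM NODES, re-lettering; the Ax one-liners -/

section Consequences

variable {F N}
variable {Χ : CentreMap F N} {D : FiniteEpsData F (SU N)} {w : WorldP}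

/-- A centre-map S-class record CERTIFIES its parameters' χ-generic provisos, admissibility and datum. [cite: Balaban1989LargeFieldI, (0.3)–(0.4) p.176 (bookkeeping)] -/
theorem exists_provisos_of_isRecordOfRecord₁₃CSepCoPHSCmap (h : IsRecordOfRecord₁₃CSepCoPHSCmap F N Χ D w) :
    ∃ (θ : Stage13HParams F N) (hP : θ.Provisos₁₃SepCoPHChi F N (Χ θ.toStage13Params)), θ.Admissible F N ∧
      D = datumOfRecord₁₃SepCoPHChi F N θ (Χ θ.toStage13Params) hP := by
  obtain ⟨θ, hP, hθ, hD, -⟩ := h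
  exact ⟨θ, hP, hθ, hD⟩

/-- The world is bound to the datum's construction. [cite: Balaban1989LargeFieldII, Thm 1 + (0.1) pp.355–356 (bookkeeping)] -/
theorem construction_eq_of_isRecordOfRecord₁₃CSepCoPHSCmap (h : IsRecordOfRecord₁₃CSepCoPHSCmap F N Χ D w) : w.C = D.C := by
  obtain ⟨θ, hP, -, -, hC, -⟩ := h
  exact hC

/-- The world's window is non-degenerate. [cite: Balaban1987RG1, (0.20) p.256 (bookkeeping)] -/
theorem gamma_pos_of_isRecordOfRecord₁₃CSepCoPHSCmap (h : IsRecordOfRecord₁₃CSepCoPHSCmap F N Χ D w) : 0 < w.γ := by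
  obtain ⟨θ, hP, -, -, -, hγ, -⟩ := h
  exact hγ.1

/-- Some window `0 < w.γ ≤ θ.γ` is certified. [cite: Balaban1987RG1, (0.20) p.256 (bookkeeping)] -/
theorem exists_gamma_le_of_isRecordOfRecord₁₃CSepCoPHSCmap (h : IsRecordOfRecord₁₃CSepCoPHSCmap F N Χ D w) :
    ∃ (θ : Stage13HParams F N) (_ : θ.Provisos₁₃SepCoPHChi F N (Χ θ.toStage13Params)), 0 < w.γ ∧ w.γ ≤ θ.γ := by
  obtain ⟨θ, hP, -, -, -, hγ, -⟩ := h
  exact ⟨θ, hP, hγ⟩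

/-- The datum of a centre-map S-class record is a datum of record, Stage 0 (averaging of record; face `rfl` at the χ-generic datum). [cite: Balaban1989LargeFieldII, (0.1) p.356 (bookkeeping)] -/
theorem isDatumOfRecord₀_of_isRecordOfRecord₁₃CSepCoPHSCmap (h : IsRecordOfRecord₁₃CSepCoPHSCmap F N Χ D w) : IsDatumOfRecord₀ F N D := by
  obtain ⟨θ, hP, -, hD, -⟩ := h
  rw [hD]; exact isDatumOfRecord₀_datumOfRecord₁₃SepCoPH_chi F N θ _ hP

/-- … and printed-averaged. [cite: Balaban1987RG1, (0.4) p.253 (bookkeeping)] -/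
theorem isPrintedAveraged_of_isRecordOfRecord₁₃CSepCoPHSCmap (h : IsRecordOfRecord₁₃CSepCoPHSCmap F N Χ D w) : D.IsPrintedAveraged := by
  obtain ⟨θ, hP, -, hD, -⟩ := h
  rw [hD]; exact isPrintedAveraged_datumOfRecord₁₃SepCoPH_chi F N θ _ hP

/-- **THE SAME-CONSTANTS C-COMPANION** at a centre map: re-binding the world's upstream blocks to the C-BINDING over the χ-generic Stage-13 view at the presenting parameter (every other
constant of the world kept) gives a node00-def-Y `IsRecordOfRecord₁₃CSepCoPHCmap Χ` record AT THE SAME DATUM — through which the S-class reads the C-class's whole consequence family (the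
world-level leaves read `w.C`, `w.γ`, `w.L`, `w.b`, `w.βup` only). [cite: Balaban1989LargeFieldII, Thm 1 + (0.1) pp.355–356; Balaban1985RegularSpaces, Thm 8 p.101 (bookkeeping)] -/
theorem companionC_of_isRecordOfRecord₁₃CSepCoPHSCmap (h : IsRecordOfRecord₁₃CSepCoPHSCmap F N Χ D w) :
    ∃ w' : WorldP, IsRecordOfRecord₁₃CSepCoPHCmap F N Χ D w' ∧ w'.C = w.C ∧ w'.γ = w.γ ∧ w'.L = w.L ∧ w'.b = w.b ∧ w'.βup = w.βup := by
  obtain ⟨θ, hP, hθ, hD, hC, hγ, hL, hup⟩ := h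
  exact ⟨{ w with up := fun P => upOfRecord₅C F N (θ.toStage5₁₃CoPHChi F N (Χ θ.toStage13Params)) P }, ⟨θ, hP, hθ, hD, hC, hγ, hL, fun _ => rfl⟩,
    rfl, rfl, rfl, rfl, rfl⟩

/-- **GUARDED (0.20) AT EVERY CENTRE-MAP S-CLASS RECORD**: the leaf reads `w.C`, `w.γ` only — node00-def-Y's C door `rgFlow_of_smallCouplings_of_isRecordOfRecord₁₃CSepCoPHCmap` at the
C-companion, parent :118 verbatim (equivalently §0 at the presenting parameter). [cite: Balaban1987RG1, (0.20) p.256] -/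
theorem rgFlow_of_smallCouplings_of_isRecordOfRecord₁₃CSepCoPHSCmap (h : IsRecordOfRecord₁₃CSepCoPHSCmap F N Χ D w) (P : B12.RunParams)
    (hsc : (leavesP w P).smallCouplings) : (leavesP w P).rgFlow := by
  obtain ⟨θ, hP, hθ, hD, hC, hγ, hL, hup⟩ := h
  have hR' : IsRecordOfRecord₁₃CSepCoPHCmap F N Χ D { w with up := fun P => upOfRecord₅C F N (θ.toStage5₁₃CoPHChi F N (Χ θ.toStage13Params)) P } :=
    ⟨θ, hP, hθ, hD, hC, hγ, hL, fun _ => rfl⟩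
  exact rgFlow_of_smallCouplings_of_isRecordOfRecord₁₃CSepCoPHCmap hR' P hsc

/-- **END FROM NODES AT ANY CENTRE-MAP S-CLASS RECORD**: the DAG's nodes at every run and the β bounds in a window `γ₀ ≥ w.γ` give print's END STATEMENT for `D.C`
(node00-def's `endStatementBPrinted_of_nodesP_interval_guarded` with the guarded (0.20) leaf above).
[cite: Balaban1989LargeFieldII, Thm 1 + (0.1) pp.355–356; Balaban1987RG1, (0.20) p.256; Balaban1988Convergent, Thms 1–2 pp.262–263 (bookkeeping)] -/
theorem endStatementBPrinted_of_isRecordOfRecord₁₃CSepCoPHSCmap_of_nodes (h : IsRecordOfRecord₁₃CSepCoPHSCmap F N Χ D w) {γ₀ : ℝ} (hγ₀ : w.γ ≤ γ₀)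
    (hnodes : ∀ P, Nodes (leavesP w P)) (hβ : BetaBoundsInInterval w.C.toB12 γ₀ w.b w.βup) :
    B16.EndStatementBPrinted D.C := by
  rw [← construction_eq_of_isRecordOfRecord₁₃CSepCoPHSCmap h]
  exact endStatementBPrinted_of_nodesP_interval_guarded w (gamma_pos_of_isRecordOfRecord₁₃CSepCoPHSCmap h) hγ₀ hnodes
    (rgFlow_of_smallCouplings_of_isRecordOfRecord₁₃CSepCoPHSCmap h) hβ

/-- **RE-LETTERING**: the S-class does not read the floor `w.b` and accepts any smaller positive window (dag-n24-w1's `isRecordOfRecord₁₃CSepCoPHS_reletter_of_le`, at any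
centre map). [cite: Balaban1989LargeFieldII, Thm 1 p.355 (bookkeeping)] -/
theorem isRecordOfRecord₁₃CSepCoPHSCmap_reletter_of_le (hR : IsRecordOfRecord₁₃CSepCoPHSCmap F N Χ D w)
    {γ' b' : ℝ} (hγ'0 : 0 < γ') (hγ' : γ' ≤ w.γ) (hb' : 0 < b') :
    IsRecordOfRecord₁₃CSepCoPHSCmap F N Χ D { w with γ := γ', b := b', b_pos := hb' } := by
  obtain ⟨θ', h', hθ', hD, hC, hγ, hL, hup⟩ := hR
  exact ⟨θ', h', hθ', hD, hC, ⟨hγ'0, hγ'.trans hγ.2⟩, hL, hup⟩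

/-! ### The Ax one-liners (row (4) names) -/

/-- (Ax) An Ax-S-class record certifies its parameters' Ax provisos, admissibility and Ax datum. [cite: Balaban1989LargeFieldI, (0.3)–(0.4) p.176 (bookkeeping)] -/
theorem exists_provisos_of_isRecordOfRecord₁₃CSepCoPHSAx (h : IsRecordOfRecord₁₃CSepCoPHSAx F N D w) :
    ∃ (θ : Stage13HParams F N) (hP : θ.Provisos₁₃SepCoPHAx F N), θ.Admissible F N ∧ D = datumOfRecord₁₃SepCoPHAx F N θ hP :=
  exists_provisos_of_isRecordOfRecord₁₃CSepCoPHSCmap h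

/-- (Ax) Some window `0 < w.γ ≤ θ.γ` is certified. [cite: Balaban1987RG1, (0.20) p.256 (bookkeeping)] -/
theorem exists_gamma_le_of_isRecordOfRecord₁₃CSepCoPHSAx (h : IsRecordOfRecord₁₃CSepCoPHSAx F N D w) :
    ∃ (θ : Stage13HParams F N) (_ : θ.Provisos₁₃SepCoPHAx F N), 0 < w.γ ∧ w.γ ≤ θ.γ :=
  exists_gamma_le_of_isRecordOfRecord₁₃CSepCoPHSCmap h

/-- (Ax) The same-constants C-companion of an Ax-S-class record is a node00-def-Y Ax-C-class record at the same datum. [cite: Balaban1989LargeFieldII, Thm 1 + (0.1) pp.355–356 (bookkeeping)] -/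
theorem companionC_of_isRecordOfRecord₁₃CSepCoPHSAx (h : IsRecordOfRecord₁₃CSepCoPHSAx F N D w) :
    ∃ w' : WorldP, IsRecordOfRecord₁₃CSepCoPHCAx F N D w' ∧ w'.C = w.C ∧ w'.γ = w.γ ∧ w'.L = w.L ∧ w'.b = w.b ∧ w'.βup = w.βup :=
  companionC_of_isRecordOfRecord₁₃CSepCoPHSCmap h

/-- (Ax) The world is bound to the Ax datum's construction. [cite: Balaban1989LargeFieldII, Thm 1 + (0.1) pp.355–356 (bookkeeping)] -/
theorem construction_eq_of_isRecordOfRecord₁₃CSepCoPHSAx (h : IsRecordOfRecord₁₃CSepCoPHSAx F N D w) : w.C = D.C :=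
  construction_eq_of_isRecordOfRecord₁₃CSepCoPHSCmap h

/-- (Ax) The world's window is non-degenerate. [cite: Balaban1987RG1, (0.20) p.256 (bookkeeping)] -/
theorem gamma_pos_of_isRecordOfRecord₁₃CSepCoPHSAx (h : IsRecordOfRecord₁₃CSepCoPHSAx F N D w) : 0 < w.γ :=
  gamma_pos_of_isRecordOfRecord₁₃CSepCoPHSCmap h

/-- (Ax) GUARDED (0.20) at every Ax-S-class record. [cite: Balaban1987RG1, (0.20) p.256] -/
theorem rgFlow_of_smallCouplings_of_isRecordOfRecord₁₃CSepCoPHSAx (h : IsRecordOfRecord₁₃CSepCoPHSAx F N D w) (P : B12.RunParams)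
    (hsc : (leavesP w P).smallCouplings) : (leavesP w P).rgFlow :=
  rgFlow_of_smallCouplings_of_isRecordOfRecord₁₃CSepCoPHSCmap h P hsc

/-- (Ax) END FROM NODES at any Ax-S-class record. [cite: Balaban1989LargeFieldII, Thm 1 + (0.1) pp.355–356; Balaban1988Convergent, Thms 1–2 pp.262–263 (bookkeeping)] -/
theorem endStatementBPrinted_of_isRecordOfRecord₁₃CSepCoPHSAx_of_nodes (h : IsRecordOfRecord₁₃CSepCoPHSAx F N D w) {γ₀ : ℝ} (hγ₀ : w.γ ≤ γ₀)
    (hnodes : ∀ P, Nodes (leavesP w P)) (hβ : BetaBoundsInInterval w.C.toB12 γ₀ w.b w.βup) :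
    B16.EndStatementBPrinted D.C :=
  endStatementBPrinted_of_isRecordOfRecord₁₃CSepCoPHSCmap_of_nodes h hγ₀ hnodes hβ

/-- (Ax) RE-LETTERING at the Ax S-class. [cite: Balaban1989LargeFieldII, Thm 1 p.355 (bookkeeping)] -/
theorem isRecordOfRecord₁₃CSepCoPHSAx_reletter_of_le (hR : IsRecordOfRecord₁₃CSepCoPHSAx F N D w)
    {γ' b' : ℝ} (hγ'0 : 0 < γ') (hγ' : γ' ≤ w.γ) (hb' : 0 < b') :
    IsRecordOfRecord₁₃CSepCoPHSAx F N D { w with γ := γ', b := b', b_pos := hb' } :=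
  isRecordOfRecord₁₃CSepCoPHSCmap_reletter_of_le hR hγ'0 hγ' hb'

end Consequences

end Literature.MathematicalPhysics.QuantumFieldTheory.Balaban1983to89.Node00

end
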